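import Summits.ABC.ABC.Theorems.SoloBlindCycloRad
import Summits.ABC.ABC.Theorems.SoloBlindPolyABC
import Summits.ABC.ABC.Theorems.SoloBlindBakerXi
import Literature.NumberTheory.DiophantineGeometry.AbcQualityProofs
import HarnessLib

/-!
# The two-prime Pillai family: what polynomial abc (hence abc) says about `p ^ a − q ^ b = 2`

Solo seat `solo-ABC-blind` (gen 2), namespace `Summit.ABC.ABC.Theorems`.

The abc triples `(2, q ^ b, p ^ a)` with `p, q` primes and `p ^ a = q ^ b + 2` form the smallest family
on which the "product of heights versus sum of heights" requirement of an abc-strength estimate for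
linear forms in logarithms is visible (A. Baker, *Experiments on the abc-conjecture*, Publ. Math.
Debrecen 65 (2004), §2, p. 256, requirement (ii)): here the radical is `2pq`, Baker's `Ξ` is just
`|a log p − b log q|`, and two-logarithm estimates bound `log c = a log p` by a multiple of
`log p · log q`, not of `log p + log q`.

This file records, sorry-free, what the *polynomial* abc inequality `PolyABC K`
(`c ≤ C · rad(abc)^K`, file `SoloBlindCycloRad`) already forces on this family:

* `pillaiTail_finite_of_polyABC`: if `PolyABC K` holds and `m₀` is a natural number with `2K < m₀`
  and `2 ≤ m₀`, then only finitely many quadruples `(p, q, a, b)` of primes `p, q` and exponents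
  `a, b ≥ m₀` satisfy `p ^ a = q ^ b + 2`;
* `pillaiTail_finite_of_abc`: under `ABC`, only finitely many pairs of prime powers `p ^ a`, `q ^ b`
  with `a, b ≥ 3` differ by `2`.

So even one polynomial abc inequality decides a case of Pillai's conjecture (finiteness of
`a x^m − b y^n = k` in `m, n, x, y > 1`), which is proved only for `a = b = k = 1` (Catalan;
T. N. Shorey, R. Tijdeman, *Exponential Diophantine Equations*, Cambridge 1986, Ch. 12, discussion
before Theorem 12.3). The proof is the elementary squeeze `p^{m₀−K} ≤ C 2^K q^K`,
`q^{m₀−K} ≤ C 2^K p^K`, whence `(pq)^{m₀−2K} ≤ C² 4^K`.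
-/

open UniqueFactorizationMonoid

namespace Summit.ABC.ABC.Theorems

open Literature.NumberTheory.DiophantineGeometry

/-- The set of "Pillai quadruples at distance two with both exponents at least `m₀`":
primes `p, q` and exponents `a, b ≥ m₀` with `p ^ a = q ^ b + 2`, coded as `(p, q, a, b)`. -/
def pillaiTwoTail (m₀ : ℕ) : Set (ℕ × ℕ × ℕ × ℕ) :=
  {s | s.1.Prime ∧ s.2.1.Prime ∧ m₀ ≤ s.2.2.1 ∧ m₀ ≤ s.2.2.2 ∧ s.1 ^ s.2.2.1 = s.2.1 ^ s.2.2.2 + 2}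

/-- In the tail `b ≥ 2`, the prime `q` is odd (else `p ^ a = 2 ^ b + 2 ≡ 2 (mod 4)` forces `p = 2`,
`a = 1`, contradicting `a ≥ 2`). -/
theorem pillai_q_ne_two {p q a b : ℕ} (hp : p.Prime) (ha : 2 ≤ a) (hb : 2 ≤ b)
    (h : p ^ a = q ^ b + 2) : q ≠ 2 := by
  rintro rfl
  have h2p : 2 ∣ p ^ a := by
    rw [h]
    exact dvd_add (dvd_pow_self 2 (by omega)) (dvd_refl 2)
  have hp2 : p = 2 := by
    have := (Nat.prime_dvd_prime_iff_eq Nat.prime_two hp).mp (Nat.prime_two.dvd_of_dvd_pow h2p)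
    exact this.symm
  subst hp2
  have h4a : 2 ^ 2 ∣ 2 ^ a := pow_dvd_pow 2 ha
  have h4b : 2 ^ 2 ∣ 2 ^ b := pow_dvd_pow 2 hb
  have h42 : 2 ^ 2 ∣ 2 := (Nat.dvd_add_right h4b).mp (h ▸ h4a)
  exact absurd (Nat.le_of_dvd (by norm_num) h42) (by norm_num)

/-- `(2, q ^ b, p ^ a)` is an abc triple when `p ^ a = q ^ b + 2`, `b ≥ 1` and `q` is an odd prime. -/
theorem isABCTriple_two_pow_pow {p q a b : ℕ} (hq : q.Prime) (hq2 : q ≠ 2) (hb : 1 ≤ b)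
    (h : p ^ a = q ^ b + 2) : IsABCTriple 2 (q ^ b) (p ^ a) := by
  refine ⟨by norm_num, pow_pos hq.pos _, by omega, ?_⟩
  have hodd : ¬ 2 ∣ q := by
    intro h2
    exact hq2 ((Nat.prime_dvd_prime_iff_eq Nat.prime_two hq).mp h2).symm
  exact (Nat.coprime_pow_right_iff hb _ _).mpr
    ((Nat.coprime_primes Nat.prime_two hq).mpr (Ne.symm hq2))

/-- The radical of the triple `(2, q ^ b, p ^ a)` is at most `2pq` (as a real number). -/
theorem rad_two_pow_pow_le {p q a b : ℕ} (hp : p.Prime) (hq : q.Prime) (ha : a ≠ 0) (hb : b ≠ 0) :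
    ((rad 2 (q ^ b) (p ^ a) : ℕ) : ℝ) ≤ 2 * (p : ℝ) * (q : ℝ) := by
  have h := rad_le_mul 2 (q ^ b) (p ^ a)
  rw [radical_pow q hb, radical_pow p ha, radical_eq_self_of_prime hp,
    radical_eq_self_of_prime hq, radical_eq_self_of_prime Nat.prime_two] at h
  push_cast at h
  linarith [h]

/-- Core squeeze: from `p ^ a ≤ C (2pq)^K`, `q ^ b ≤ p ^ a`, `a, b ≥ m₀ > 2K` one gets
`p * q ≤ (C ^ 2 * 4 ^ K) ^ (1 / (m₀ - 2K))`. -/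
theorem mul_le_of_pow_le {p q : ℕ} {a b m₀ : ℕ} {C K : ℝ} (hp : 2 ≤ p) (hq : 2 ≤ q) (hC : 0 < C)
    (hm : 2 * K < m₀) (ha : m₀ ≤ a) (hb : m₀ ≤ b)
    (h1 : (p : ℝ) ^ (a : ℝ) ≤ C * (2 * p * q) ^ K) (h2 : (q : ℝ) ^ (b : ℝ) ≤ C * (2 * p * q) ^ K) :
    (p : ℝ) * q ≤ (C ^ 2 * 4 ^ K) ^ (1 / ((m₀ : ℝ) - 2 * K)) := by
  have hp1 : (1 : ℝ) ≤ p := by exact_mod_cast (by omega : 1 ≤ p)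
  have hq1 : (1 : ℝ) ≤ q := by exact_mod_cast (by omega : 1 ≤ q)
  have hp0 : (0 : ℝ) < p := by linarith
  have hq0 : (0 : ℝ) < q := by linarith
  -- lower the exponents to m₀
  have h1' : (p : ℝ) ^ (m₀ : ℝ) ≤ C * (2 * p * q) ^ K :=
    (Real.rpow_le_rpow_of_exponent_le hp1 (by exact_mod_cast ha)).trans h1
  have h2' : (q : ℝ) ^ (m₀ : ℝ) ≤ C * (2 * p * q) ^ K :=
    (Real.rpow_le_rpow_of_exponent_le hq1 (by exact_mod_cast hb)).trans h2
  -- multiply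
  have hmul : ((p : ℝ) * q) ^ (m₀ : ℝ) ≤ (C * (2 * p * q) ^ K) ^ 2 := by
    rw [Real.mul_rpow hp0.le hq0.le, sq]
    exact mul_le_mul h1' h2' (by positivity) (by positivity)
  have hexp : (C * (2 * (p : ℝ) * q) ^ K) ^ 2 = C ^ 2 * 4 ^ K * ((p : ℝ) * q) ^ (2 * K) := by
    have h4 : (4 : ℝ) ^ K = (2 : ℝ) ^ K * 2 ^ K := by
      rw [show (4 : ℝ) = 2 * 2 by norm_num, Real.mul_rpow (by norm_num) (by norm_num)]
    rw [mul_pow, ← Real.rpow_natCast ((2 * (p : ℝ) * q) ^ K) 2, ← Real.rpow_mul (by positivity),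
      show (2 * (p : ℝ) * q) = 2 * ((p : ℝ) * q) by ring, Real.mul_rpow (by norm_num) (by positivity),
      h4]
    push_cast
    rw [show K * (2 : ℝ) = 2 * K by ring, Real.mul_rpow (by norm_num) (by norm_num)]
    have : (2 : ℝ) ^ (2 * K) = 2 ^ K * 2 ^ K := by
      rw [two_mul, Real.rpow_add (by norm_num)]
    rw [this]; ring
  rw [hexp] at hmul
  -- divide by (pq)^(2K)
  have hpq1 : (1 : ℝ) ≤ (p : ℝ) * q := by nlinarith
  have hpos : (0 : ℝ) < ((p : ℝ) * q) ^ (2 * K) := by positivity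
  have hkey : ((p : ℝ) * q) ^ ((m₀ : ℝ) - 2 * K) ≤ C ^ 2 * 4 ^ K := by
    rw [Real.rpow_sub (by positivity), div_le_iff₀ hpos]
    exact hmul
  have hθ : (0 : ℝ) < (m₀ : ℝ) - 2 * K := by linarith
  exact le_rpow_one_div_of_rpow_le hθ (by positivity) hkey

/-- **Polynomial abc decides the distance-two Pillai tail.** If `c ≤ C · rad(abc) ^ K` for all abc
triples, then for every `m₀` with `2K < m₀` and `2 ≤ m₀` only finitely many `(p, q, a, b)` with
`p, q` prime, `a, b ≥ m₀` satisfy `p ^ a = q ^ b + 2`. -/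
theorem pillaiTail_finite_of_polyABC {K : ℝ} (hK : PolyABC K) {m₀ : ℕ} (hm : 2 * K < (m₀ : ℝ))
    (hm2 : 2 ≤ m₀) : (pillaiTwoTail m₀).Finite := by
  have hK0 : 0 < K := polyABC_pos hK
  obtain ⟨C, hC, hPoly⟩ := hK
  -- a uniform box
  set B : ℝ := (C ^ 2 * 4 ^ K) ^ (1 / ((m₀ : ℝ) - 2 * K)) with hBdef
  set B' : ℝ := C * (2 * B) ^ K with hB'def
  obtain ⟨N, hN⟩ := exists_nat_gt (max B B')
  have hbox : pillaiTwoTail m₀ ⊆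
      (Set.Iic N) ×ˢ ((Set.Iic N) ×ˢ ((Set.Iic N) ×ˢ (Set.Iic N))) := by
    rintro ⟨p, q, a, b⟩ ⟨hp, hq, ha, hb, h⟩
    simp only at hp hq ha hb h
    have ha2 : 2 ≤ a := le_trans hm2 ha
    have hb2 : 2 ≤ b := le_trans hm2 hb
    have hq2 : q ≠ 2 := pillai_q_ne_two hp ha2 hb2 h
    have hT : IsABCTriple 2 (q ^ b) (p ^ a) := isABCTriple_two_pow_pow hq hq2 (by omega) h
    have hc := hPoly 2 (q ^ b) (p ^ a) hT
    have hrad := rad_two_pow_pow_le (a := a) (b := b) hp hq (by omega) (by omega)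
    have hp2 : 2 ≤ p := hp.two_le
    have hq2' : 2 ≤ q := hq.two_le
    have hradK : C * ((rad 2 (q ^ b) (p ^ a) : ℕ) : ℝ) ^ K ≤ C * (2 * (p : ℝ) * q) ^ K :=
      mul_le_mul_of_nonneg_left (Real.rpow_le_rpow (by positivity) hrad hK0.le) hC.le
    have h1 : (p : ℝ) ^ (a : ℝ) ≤ C * (2 * p * q) ^ K := by
      rw [Real.rpow_natCast]; push_cast at hc; exact hc.trans hradK
    have hqb_le : (q : ℝ) ^ (b : ℝ) ≤ (p : ℝ) ^ (a : ℝ) := by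
      rw [Real.rpow_natCast, Real.rpow_natCast]; exact_mod_cast (by omega : q ^ b ≤ p ^ a)
    have h2 : (q : ℝ) ^ (b : ℝ) ≤ C * (2 * p * q) ^ K := hqb_le.trans h1
    have hpq : (p : ℝ) * q ≤ B := mul_le_of_pow_le hp2 hq2' hC hm ha hb h1 h2
    have hp1 : (1 : ℝ) ≤ p := by exact_mod_cast (by omega : 1 ≤ p)
    have hq1 : (1 : ℝ) ≤ q := by exact_mod_cast (by omega : 1 ≤ q)
    have hpB : (p : ℝ) ≤ B := le_trans (by nlinarith) hpq
    have hqB : (q : ℝ) ≤ B := le_trans (by nlinarith) hpq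
    have hB0 : 0 ≤ B := le_trans (by positivity) hpB
    -- exponents: 2^a ≤ p^a ≤ C (2pq)^K ≤ C (2B·?)^K ; we use 2pq ≤ 2B (since pq ≤ B)
    have h2pq : 2 * (p : ℝ) * q ≤ 2 * B := by nlinarith
    have hpa_le : (p : ℝ) ^ (a : ℝ) ≤ B' :=
      h1.trans (mul_le_mul_of_nonneg_left (Real.rpow_le_rpow (by positivity) h2pq hK0.le) hC.le)
    have hqb_le' : (q : ℝ) ^ (b : ℝ) ≤ B' := hqb_le.trans hpa_le
    -- a ≤ 2^a ≤ p^a ≤ B'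
    have ha_le : (a : ℝ) ≤ B' := by
      have h2a : (a : ℝ) ≤ (2 : ℝ) ^ (a : ℝ) := by
        rw [Real.rpow_natCast]; exact_mod_cast (Nat.lt_two_pow_self).le
      have : (2 : ℝ) ^ (a : ℝ) ≤ (p : ℝ) ^ (a : ℝ) :=
        Real.rpow_le_rpow (by norm_num) (by exact_mod_cast hp2) (by positivity)
      exact h2a.trans (this.trans hpa_le)
    have hb_le : (b : ℝ) ≤ B' := by
      have h2b : (b : ℝ) ≤ (2 : ℝ) ^ (b : ℝ) := by
        rw [Real.rpow_natCast]; exact_mod_cast (Nat.lt_two_pow_self).le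
      have : (2 : ℝ) ^ (b : ℝ) ≤ (q : ℝ) ^ (b : ℝ) :=
        Real.rpow_le_rpow (by norm_num) (by exact_mod_cast hq2') (by positivity)
      exact h2b.trans (this.trans hqb_le')
    have hmaxB : B < N := lt_of_le_of_lt (le_max_left _ _) hN
    have hmaxB' : B' < N := lt_of_le_of_lt (le_max_right _ _) hN
    simp only [Set.mem_prod, Set.mem_Iic]
    refine ⟨?_, ?_, ?_, ?_⟩
    · exact_mod_cast (hpB.trans hmaxB.le)
    · exact_mod_cast (hqB.trans hmaxB.le)
    · exact_mod_cast (ha_le.trans hmaxB'.le)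
    · exact_mod_cast (hb_le.trans hmaxB'.le)
  exact ((Set.finite_Iic N).prod ((Set.finite_Iic N).prod
    ((Set.finite_Iic N).prod (Set.finite_Iic N)))).subset hbox

/-- **abc decides prime-power Pillai at distance two beyond squares**: under the abc conjecture only
finitely many pairs of prime powers `p ^ a`, `q ^ b` with `a, b ≥ 3` differ by `2`. -/
theorem pillaiTail_finite_of_abc (habc : ABC) : (pillaiTwoTail 3).Finite := by
  have hK : PolyABC (5 / 4) := (abc_iff_polyABC.mp habc) (5 / 4) (by norm_num)
  exact pillaiTail_finite_of_polyABC hK (by norm_num) (by norm_num)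

end Summit.ABC.ABC.Theorems
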